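import Summits.QuantumFields.YangMills.Theses.SqueezedSkewness
import Summits.QuantumFields.YangMills.Theorems.SqueezedSkewnessAntipodalMarkovDictionary
import Summits.QuantumFields.YangMills.Theorems.UniversalDetectorReflectedKernel
import Summits.QuantumFields.YangMills.Theorems.ThermalDescentSeamFromMoments
import Summits.QuantumFields.YangMills.Theorems.LangevinControlUVOSLegsFromFemtoAndGapStubCollar6
import Summits.QuantumFields.YangMills.Theorems.BalabanLadderNTCumulantPolarisationDefs
import Summits.QuantumFields.YangMills.Theorems.BalabanLadderNTReferencePackageScales
import HarnessLib

/-!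
# Route `SqueezedSkewness`, support `FemtoCeiling` (stmt-QuantumFields-23547, LINE χ «chord escalator») — BY NAME

In any unit carrying the plane-resolved femto boundary law `FBL6 G r a` — hence the collar output `MomentBounds6` by the LANDED
`DlrCollarTransfer.stub_collar6` — every femto time-translate `g = v(· + a k e₀)` of a slab bump `v` (`tsupport v ⊆ {δ₁ < y₀ < δ₂}`)
whose lower edge stays `δ₁ − a k ≥ h_c > 0` has a reflection form `Qrp(g) ≤ C` on every large hypercube `(2L+1)⁴`, with ONE `C`
for all `β ≥ β₆`, `a(β)L ≥ Λ₆`, `k`.  Proof (planner ym-idea-6 g12's route, made exact):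
* `Qrp(g) = Cov_T(Φ_g ∘ Θ₀, Φ_g)`, `Φ_g = Σ_u g(a·u)·dens u` — the reflected `Fin`-torus ↔ `torusE` dictionary
  (`AntipodalMarkovDictionary.covF_toFin_reflF`, `toFin_dens_zOf`); bilinearity (`UniversalDetectorPlaneTight.cov_sum_mul_sum`);
* each CHARGED mirror pair (both weights non-zero ⇒ both sites in the slab, `window_of_ne_zero`) is `> 2h_c/a` apart in time,
  cyclically on the odd torus (`sep_charged`), so the mirror pairing `cov_dens_mul_dens_cfgReflect_eq_sum` (36 plane pairs, the
  electric ones read one unit lower) and the `n = 2` collar output at `R = ⌊c₀/a⌋`, `c₀ = min(h_c/4, ℓ₄)` (`abs_cov_plane_le`,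
  `abs_cov_dens_reflect_le`) bound it by `36 (C/R⁴)² ≤ 36·2⁸C²a⁸/c₀⁸`;
* the weights: `Σ_u |g(a·u)| ≤ K_v (1+|δ₁|)⁸ 4⁴ / a⁴` (Schwartz decay `exists_abs_le_decay`, translation `inv_bracket_add_le`, the
  tree's uniform lattice Riemann bound `latticeRiemannBound`) — the powers of `a` cancel: `C = K'²·36·C²·(2/c₀)⁸`.
Thresholds: `a(β) ≤ min(c₀/2, 3h_c/8, 1)`, `a(β)·L ≥ max(2|δ₂| + 1, 4c₀ + 8)`.

Fleet lead `ym-spine-19353-p1` g19.  HONEST FRAMING: a CONDITIONAL ceiling (`FBL6` is the hypothesis of the item and is NOT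
proved); no crux, NT statement, rung of record or mass gap follows. [folklore]
-/

set_option autoImplicit false

noncomputable section
open MeasureTheory Filter Topology
open Literature.MathematicalPhysics.QuantumFieldTheory Literature.MathematicalPhysics.QuantumLattice
open Literature.Probability.LatticeModels (box)
open Summit.QuantumFields.YangMills.Cruxes.OSLegsFromFemtoAndGap.DlrCollarTransfer
open Summit.QuantumFields.YangMills.Theorems.ThermalDescentTorusDictionary (eF aF wF zOf ccZ sum_box_eq_sum_fin)
open Summit.QuantumFields.YangMills.Theorems.AntipodalMarkovDictionary (covF_toFin_reflF toFin_dens_zOf)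
open Summit.QuantumFields.YangMills.Cruxes.UniversalDetectorPlaneTight (cov_sum_mul_sum cov_dens_mul_dens_cfgReflect_eq_sum)
open Summit.QuantumFields.YangMills.Cruxes.NT.ConjugateResponse (torusE_comp_cfgReflect)
open Summit.QuantumFields.YangMills.Cruxes.UniversalDetectorLimitExtraction (latticeRiemannBound)
open Summit.QuantumFields.YangMills.Cruxes.NT.Reference (eventually_le_of_tendsto div_pow_depth_le)
open Summit.QuantumFields.YangMills.Cruxes.NT.MarkovMirror (torusE_const_mul)

namespace Summit.QuantumFields.YangMills.Theorems.FemtoCeilingProof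

variable (G : Type) [Group G] [TopologicalSpace G] [IsTopologicalGroup G] [CompactSpace G]
  [MeasurableSpace G] [BorelSpace G] (r : LatticeRep G)
/-! ## §1 The `n = 2` collar output for a pair of plane fields, and for a density against a reflected density -/

/-- **Two plane fields separated in time have small torus covariance** (the `n = 2` case of `MomentBounds6` at one
coupling: `|Cov_T(plane_p X, plane_q Y)| ≤ (C/R⁴)²` once the centred times of `X`, `Y` are `≥ 2R + 4` apart cyclically).
[folklore] -/
theorem abs_cov_plane_le (β : ℝ) (L : ℕ) {C : ℝ} {R : ℕ}
    (H : ∀ (n : ℕ) (q : Fin n → Fin 4 × Fin 4) (x : Fin n → (Fin 4 → ℤ)), (∀ i, (q i).1 < (q i).2) →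
      (∀ i j : Fin n, i ≠ j → ∃ k : Fin 4,
        (2 * (R : ℤ) + 4) ≤ |((((x i k - x j k : ℤ) : ZMod (2 * L + 1))).valMinAbs : ℤ)|) →
      |torusE G r β L (fun U => ∏ i, (plane G r (q i) (x i) U - torusE G r β L (plane G r (q i) (x i))))| ≤
        (C / (R : ℝ) ^ 4) ^ n)
    (p q : {q : Fin 4 × Fin 4 // q.1 < q.2}) (X Y : Fin 4 → ℤ)
    (hsep : (2 * (R : ℤ) + 4) ≤ |((((X 0 - Y 0 : ℤ) : ZMod (2 * L + 1))).valMinAbs : ℤ)|) :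
    |torusE G r β L (fun V => plane G r p.1 X V * plane G r q.1 Y V) -
        torusE G r β L (plane G r p.1 X) * torusE G r β L (plane G r q.1 Y)| ≤ (C / (R : ℝ) ^ 4) ^ 2 := by
  have hsep' : ∀ i j : Fin 2, i ≠ j → ∃ m : Fin 4, (2 * (R : ℤ) + 4) ≤
      |((((![X, Y] i m - ![X, Y] j m : ℤ) : ZMod (2 * L + 1))).valMinAbs : ℤ)| := by
    intro i j hij
    fin_cases i <;> fin_cases j
    · exact absurd rfl hij
    · exact ⟨0, by simpa using hsep⟩
    · refine ⟨0, ?_⟩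
      have h : ((Y 0 - X 0 : ℤ) : ZMod (2 * L + 1)) = -((X 0 - Y 0 : ℤ) : ZMod (2 * L + 1)) := by push_cast; ring
      have hk' : (2 * (R : ℤ) + 4) ≤ |((((Y 0 - X 0 : ℤ) : ZMod (2 * L + 1))).valMinAbs : ℤ)| := by
        rw [h, Int.abs_eq_natAbs, ZMod.natAbs_valMinAbs_neg, ← Int.abs_eq_natAbs]
        exact hsep
      simpa using hk'
    · exact absurd rfl hij
  have h := H 2 ![p.1, q.1] ![X, Y] (fun i => by fin_cases i <;> simp [p.2, q.2]) hsep'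
  have hprod : (fun U => ∏ i : Fin 2, (plane G r (![p.1, q.1] i) (![X, Y] i) U -
      torusE G r β L (plane G r (![p.1, q.1] i) (![X, Y] i)))) =
      fun U => (plane G r p.1 X U - torusE G r β L (plane G r p.1 X)) *
        (plane G r q.1 Y U - torusE G r β L (plane G r q.1 Y)) := by
    funext U
    rw [Fin.prod_univ_two]
    simp
  rw [hprod, Summit.QuantumFields.YangMills.Cruxes.NT.CumulantPolarisation.torusE_centred_centred G r β L
    (continuous_plane r _ _) (continuous_plane r _ _)] at h
  have e : torusE G r β L (fun U => plane G r p.1 X U * plane G r q.1 Y U) -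
        torusE G r β L (plane G r q.1 Y) * torusE G r β L (plane G r p.1 X) -
        torusE G r β L (plane G r p.1 X) * torusE G r β L (plane G r q.1 Y) +
        torusE G r β L (plane G r p.1 X) * torusE G r β L (plane G r q.1 Y) =
      torusE G r β L (fun U => plane G r p.1 X U * plane G r q.1 Y U) -
        torusE G r β L (plane G r p.1 X) * torusE G r β L (plane G r q.1 Y) := by ring
  rwa [e] at h

/-- **A density against a reflected density** (mirror pairing + the pair bound): if for every orientation `q` the centred
time of `X` and that of the reflected (electric: one unit lower) site `σ_q θY` are `≥ 2R+4` apart cyclically, then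
`|Cov_T(dens X, dens Y ∘ Θ₀)| ≤ 36 (C/R⁴)²`. [folklore] -/
theorem abs_cov_dens_reflect_le (β : ℝ) (L : ℕ) {C : ℝ} {R : ℕ}
    (H : ∀ (n : ℕ) (q : Fin n → Fin 4 × Fin 4) (x : Fin n → (Fin 4 → ℤ)), (∀ i, (q i).1 < (q i).2) →
      (∀ i j : Fin n, i ≠ j → ∃ k : Fin 4,
        (2 * (R : ℤ) + 4) ≤ |((((x i k - x j k : ℤ) : ZMod (2 * L + 1))).valMinAbs : ℤ)|) →
      |torusE G r β L (fun U => ∏ i, (plane G r (q i) (x i) U - torusE G r β L (plane G r (q i) (x i))))| ≤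
        (C / (R : ℝ) ^ 4) ^ n)
    (X Y : Fin 4 → ℤ)
    (hsep : ∀ q : {q : Fin 4 × Fin 4 // q.1 < q.2}, (2 * (R : ℤ) + 4) ≤
      |((((X 0 - (if q.1.1 = 0 then siteReflect Y - Pi.single 0 1
        else siteReflect Y) 0 : ℤ) : ZMod (2 * L + 1))).valMinAbs : ℤ)|) :
    |torusE G r β L (fun V => dens G r X V * dens G r Y (cfgReflect V)) -
        torusE G r β L (dens G r X) * torusE G r β L (dens G r Y)| ≤ 36 * (C / (R : ℝ) ^ 4) ^ 2 := by
  rw [cov_dens_mul_dens_cfgReflect_eq_sum r β L X Y]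
  refine (Finset.abs_sum_le_sum_abs _ _).trans ?_
  have h1 : ∀ p ∈ (Finset.univ : Finset {q : Fin 4 × Fin 4 // q.1 < q.2}),
      |∑ q : {q : Fin 4 × Fin 4 // q.1 < q.2}, (torusE G r β L (fun V => plane G r p.1 X V *
          plane G r q.1 (if q.1.1 = 0 then siteReflect Y - Pi.single 0 1
            else siteReflect Y) V) -
        torusE G r β L (plane G r p.1 X) * torusE G r β L (plane G r q.1
          (if q.1.1 = 0 then siteReflect Y - Pi.single 0 1
            else siteReflect Y)))| ≤ 6 * (C / (R : ℝ) ^ 4) ^ 2 := by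
    intro p _
    refine (Finset.abs_sum_le_sum_abs _ _).trans ?_
    have h2 : ∀ q ∈ (Finset.univ : Finset {q : Fin 4 × Fin 4 // q.1 < q.2}),
        |torusE G r β L (fun V => plane G r p.1 X V *
            plane G r q.1 (if q.1.1 = 0 then siteReflect Y - Pi.single 0 1
              else siteReflect Y) V) -
          torusE G r β L (plane G r p.1 X) * torusE G r β L (plane G r q.1
            (if q.1.1 = 0 then siteReflect Y - Pi.single 0 1
              else siteReflect Y))| ≤ (C / (R : ℝ) ^ 4) ^ 2 :=
      fun q _ => abs_cov_plane_le G r β L H p q X _ (hsep q)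
    refine (Finset.sum_le_sum h2).trans ?_
    rw [Finset.sum_const, Finset.card_univ, show Fintype.card {q : Fin 4 × Fin 4 // q.1 < q.2} = 6 by decide,
      nsmul_eq_mul]
    norm_num
  refine (Finset.sum_le_sum h1).trans ?_
  rw [Finset.sum_const, Finset.card_univ, show Fintype.card {q : Fin 4 × Fin 4 // q.1 < q.2} = 6 by decide,
    nsmul_eq_mul]
  norm_num
  exact le_of_eq (by ring)
/-! ## §2 Schwartz weights on the lattice: decay, translated Riemann sums, the slab window -/

/-- Japanese brackets under a translation: `(1 + ‖z + w‖)⁻⁸ ≤ (1 + ‖w‖)⁸ (1 + ‖z‖)⁻⁸`. [folklore] -/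
theorem inv_bracket_add_le (z w : EuclideanSpace ℝ (Fin 4)) :
    ((1 + ‖z + w‖) ^ 8)⁻¹ ≤ (1 + ‖w‖) ^ 8 * ((1 + ‖z‖) ^ 8)⁻¹ := by
  have h1 : 1 + ‖z‖ ≤ (1 + ‖z + w‖) * (1 + ‖w‖) := by
    have : ‖z‖ ≤ ‖z + w‖ + ‖w‖ := by
      calc ‖z‖ = ‖(z + w) - w‖ := by rw [add_sub_cancel_right]
        _ ≤ ‖z + w‖ + ‖w‖ := norm_sub_le _ _
    nlinarith [norm_nonneg (z + w), norm_nonneg w, norm_nonneg z]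
  rw [inv_eq_one_div, inv_eq_one_div, mul_one_div, div_le_div_iff₀ (by positivity) (by positivity), one_mul]
  calc (1 + ‖z‖) ^ 8 ≤ ((1 + ‖z + w‖) * (1 + ‖w‖)) ^ 8 := pow_le_pow_left₀ (by positivity) h1 8
    _ = (1 + ‖w‖) ^ 8 * (1 + ‖z + w‖) ^ 8 := by ring

/-- **Schwartz decay of order 8**: `|v y| ≤ K_v (1 + ‖y‖)⁻⁸`. [folklore] -/
theorem exists_abs_le_decay (v : SchwartzMap (EuclideanSpace ℝ (Fin 4)) ℝ) :
    ∃ K : ℝ, 0 ≤ K ∧ ∀ y : EuclideanSpace ℝ (Fin 4), |v y| ≤ K * ((1 + ‖y‖) ^ 8)⁻¹ := by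
  set S : ℝ := (Finset.Iic ((8 : ℕ), (0 : ℕ))).sup (fun m => SchwartzMap.seminorm ℝ m.1 m.2) v with hS
  have hS0 : 0 ≤ S := apply_nonneg _ _
  refine ⟨2 ^ 8 * S, by positivity, fun y => ?_⟩
  have h := SchwartzMap.one_add_le_sup_seminorm_apply (𝕜 := ℝ) (m := ((8 : ℕ), (0 : ℕ))) (k := 8) (n := 0)
    le_rfl le_rfl v y
  rw [norm_iteratedFDeriv_zero, Real.norm_eq_abs] at h
  have h2 : (1 + ‖y‖) ^ 8 * |v y| ≤ 2 ^ 8 * S := by rw [hS]; exact h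
  have hpos : 0 < (1 + ‖y‖) ^ 8 := by positivity
  rw [← div_eq_mul_inv, le_div_iff₀ hpos, mul_comm]
  exact h2

/-- **Uniform translated Riemann bound**: `Σ_u |v(s·u + w)| ≤ K_v (1 + ‖w‖)⁸ 4⁴ / s⁴` over the odd torus (`0 < s ≤ 1`).
[folklore] -/
theorem sum_abs_translate_le {v : SchwartzMap (EuclideanSpace ℝ (Fin 4)) ℝ} {K : ℝ} (hK0 : 0 ≤ K)
    (hK : ∀ y : EuclideanSpace ℝ (Fin 4), |v y| ≤ K * ((1 + ‖y‖) ^ 8)⁻¹) (L : ℕ) {s : ℝ} (hs : 0 < s) (hs1 : s ≤ 1)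
    (w : EuclideanSpace ℝ (Fin 4)) :
    ∑ u : FinTorusSite (2 * L + 1) (2 * L + 1) (2 * L + 1) (2 * L + 1),
        |v (s • siteToE (zOf (2 * L + 1) u) + w)| ≤ K * (1 + ‖w‖) ^ 8 * 4 ^ 4 / s ^ 4 := by
  have hRB := latticeRiemannBound 4 L hs hs1
  have hs4 : 0 < s ^ 4 := by positivity
  have hsum : ∑ x ∈ box 4 L, ((1 + ‖s • siteToE x‖) ^ (2 * 4))⁻¹ ≤ 4 ^ 4 / s ^ 4 := by
    rw [le_div_iff₀ hs4, mul_comm]; exact hRB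
  calc ∑ u : FinTorusSite (2 * L + 1) (2 * L + 1) (2 * L + 1) (2 * L + 1), |v (s • siteToE (zOf (2 * L + 1) u) + w)|
      ≤ ∑ u : FinTorusSite (2 * L + 1) (2 * L + 1) (2 * L + 1) (2 * L + 1),
          K * (1 + ‖w‖) ^ 8 * ((1 + ‖s • siteToE (zOf (2 * L + 1) u)‖) ^ (2 * 4))⁻¹ := by
        refine Finset.sum_le_sum fun u _ => (hK _).trans ?_
        rw [mul_assoc]
        exact mul_le_mul_of_nonneg_left (inv_bracket_add_le _ _) hK0
    _ = K * (1 + ‖w‖) ^ 8 * ∑ x ∈ box 4 L, ((1 + ‖s • siteToE x‖) ^ (2 * 4))⁻¹ := by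
        rw [Finset.mul_sum, sum_box_eq_sum_fin]
    _ ≤ K * (1 + ‖w‖) ^ 8 * (4 ^ 4 / s ^ 4) := mul_le_mul_of_nonneg_left hsum (by positivity)
    _ = K * (1 + ‖w‖) ^ 8 * 4 ^ 4 / s ^ 4 := by ring

/-- The time coordinate of a translated smeared lattice point. [folklore] -/
theorem smul_siteToE_add_apply_zero (s t : ℝ) (z : Fin 4 → ℤ) :
    (s • siteToE z + t • EuclideanSpace.single (0 : Fin 4) (1 : ℝ)) 0 = s * (z 0 : ℝ) + t := by
  simp [siteToE_apply]

/-- **The slab window of a charged site**: if `v(s·z + t·e₀) ≠ 0` and `v` is supported in the slab `{δ₁ < y₀ < δ₂}`, then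
`δ₁ < s z₀ + t < δ₂`. [folklore] -/
theorem window_of_ne_zero {v : EuclideanSpace ℝ (Fin 4) → ℝ} {δ₁ δ₂ : ℝ}
    (hv : tsupport v ⊆ {y : EuclideanSpace ℝ (Fin 4) | δ₁ < y 0 ∧ y 0 < δ₂}) (s t : ℝ) (z : Fin 4 → ℤ)
    (hz : v (s • siteToE z + t • EuclideanSpace.single (0 : Fin 4) (1 : ℝ)) ≠ 0) :
    δ₁ < s * (z 0 : ℝ) + t ∧ s * (z 0 : ℝ) + t < δ₂ := by
  have h := hv (subset_tsupport _ (Function.mem_support.2 hz))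
  simp only [Set.mem_setOf_eq, smul_siteToE_add_apply_zero] at h
  exact h

/-- **Separation of a charged mirror pair.**  Two charged sites (times `t_x, t_y` with `δ₁ − s k < s t < δ₂ − s k`, lower edge
`δ₁ − s k ≥ h_c`), `0 < s ≤ 1`, `2|δ₂| + 1 ≤ sL`, `2R + 4 ≤ 2h_c/s`: the centred time of `y` and that of every reflected
(possibly one unit lower) copy of `x` are `≥ 2R + 4` apart cyclically on the torus `2L+1`. [folklore] -/
theorem sep_charged {δ₁ δ₂ s hc : ℝ} {k L R : ℕ} (hs : 0 < s) (hs1 : s ≤ 1) (hk : hc ≤ δ₁ - s * k)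
    (hL : 2 * |δ₂| + 1 ≤ s * L) (hR : (2 * R + 4 : ℝ) ≤ 2 * hc / s) (tx ty : ℤ)
    (hx : δ₁ < s * (tx : ℝ) + s * k ∧ s * (tx : ℝ) + s * k < δ₂) (hy : δ₁ < s * (ty : ℝ) + s * k ∧ s * (ty : ℝ) + s * k < δ₂)
    (ε : ℤ) (hε : ε = 0 ∨ ε = 1) (m : ℤ) (hm : m = ty + tx + ε) :
    (2 * (R : ℤ) + 4) ≤ |(((m : ℤ) : ZMod (2 * L + 1)).valMinAbs : ℤ)| := by
  subst hm
  have hk0 : (0 : ℝ) ≤ s * k := by positivity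
  have htx : hc / s < tx := by rw [div_lt_iff₀ hs]; linarith [hx.1]
  have hty : hc / s < ty := by rw [div_lt_iff₀ hs]; linarith [hy.1]
  have htx2 : s * (tx : ℝ) < |δ₂| := by linarith [hx.2, le_abs_self δ₂]
  have hty2 : s * (ty : ℝ) < |δ₂| := by linarith [hy.2, le_abs_self δ₂]
  have hm_ge : (2 * R + 4 : ℝ) ≤ ((ty + tx + ε : ℤ) : ℝ) := by
    have hε0 : (0 : ℝ) ≤ (ε : ℝ) := by rcases hε with h | h <;> simp [h]
    have : 2 * hc / s = hc / s + hc / s := by ring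
    push_cast; linarith
  have hm_le : ((ty + tx + ε : ℤ) : ℝ) < L := by
    have hε1 : (ε : ℝ) ≤ 1 := by rcases hε with h | h <;> simp [h]
    have h1 : s * ((ty : ℝ) + tx + ε) < s * L := by nlinarith
    push_cast
    exact lt_of_mul_lt_mul_left (by linarith) hs.le
  have hm_pos : (0 : ℝ) < ((ty + tx + ε : ℤ) : ℝ) := by
    have : (0 : ℝ) ≤ 2 * R + 4 := by positivity
    linarith
  have hmL : ty + tx + ε ≤ L := by exact_mod_cast hm_le.le
  have hm0 : 0 < ty + tx + ε := by exact_mod_cast hm_pos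
  have hval : ((((ty + tx + ε : ℤ)) : ZMod (2 * L + 1))).valMinAbs = ty + tx + ε := by
    rw [ZMod.valMinAbs_spec]
    exact ⟨rfl, by push_cast; omega, by push_cast; omega⟩
  rw [hval, abs_of_pos hm0]
  exact_mod_cast hm_ge
/-! ## §3 `FemtoCeiling` -/
/-- **`FemtoCeiling`** (item stmt-QuantumFields-23547, LINE χ «chord escalator»), BY NAME: in any unit carrying the femto boundary
law `FBL6` — hence the plane-resolved collar output `MomentBounds6` by the landed `DlrCollarTransfer.stub_collar6` — every femto
translate `g = v(· + a k e₀)` of a slab bump `v` whose lower edge stays `≥ h_c > 0` has `Qrp(g) ≤ C` on every large hypercube, with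
`C` independent of `β`, `L`, `k`.  Proof: `Qrp(g) = Cov_T(Φ_g∘Θ₀, Φ_g)`, `Φ_g = Σ_u g(a·u)·dens u` (reflected dictionary
`covF_toFin_reflF`, `toFin_dens_zOf`); bilinearity (`cov_sum_mul_sum`); each charged mirror pair is `> 2h_c/a` apart in time
(`sep_charged`), so the mirror pairing (`cov_dens_mul_dens_cfgReflect_eq_sum`) and the `n = 2` collar output with
`R = ⌊c₀/a⌋`, `c₀ = min(h_c/4, ℓ₄)` bound it by `36 (C/R⁴)² ≤ 36·2⁸C²a⁸/c₀⁸`; the weights have `Σ_u |g(a·u)| ≤ K_v(1+|δ₁|)⁸4⁴/a⁴`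
(Schwartz decay + the uniform lattice Riemann bound); the powers of `a` cancel. [folklore] -/
theorem femtoCeiling_proof : Summit.QuantumFields.YangMills.Theses.SqueezedSkewness.FemtoCeiling := by
  intro G _ _ _ _ hG r a ha ha0 hFBL
  letI : MeasurableSpace G := borel G
  haveI : BorelSpace G := ⟨rfl⟩
  haveI := r.secondCountableTopology
  dsimp only
  intro v ρ δ₁ δ₂ hc hhc hvball hvslab
  -- the collar output from the boundary law, the decay of the bump
  obtain ⟨C, β₄, ℓ₄, hℓ₄, hC0, hMB⟩ :=
    Summit.QuantumFields.YangMills.Cruxes.OSLegsFromFemtoAndGap.DlrCollarTransfer.stub_collar6 G r a hFBL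
  obtain ⟨Kv, hKv0, hKv⟩ := exists_abs_le_decay v
  -- constants
  obtain ⟨c₀, hc₀⟩ : ∃ c₀ : ℝ, c₀ = min (hc / 4) ℓ₄ := ⟨_, rfl⟩
  have hc₀0 : 0 < c₀ := by rw [hc₀]; exact lt_min (by positivity) hℓ₄
  have hc₀hc : c₀ ≤ hc / 4 := by rw [hc₀]; exact min_le_left _ _
  set K' : ℝ := Kv * (1 + |δ₁|) ^ 8 * 4 ^ 4 with hK'
  have hK'0 : 0 ≤ K' := by rw [hK']; positivity
  obtain ⟨βa, hβa⟩ := eventually_le_of_tendsto ha0 (δ := min (c₀ / 2) (min (3 * hc / 8) 1))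
    (lt_min (by positivity) (lt_min (by positivity) one_pos))
  refine ⟨K' ^ 2 * (36 * (C ^ 2 * (2 / c₀) ^ 8)), max β₄ βa, max (2 * |δ₂| + 1) (4 * c₀ + 8), fun β hβ L hL k g hk hg => ?_⟩
  have hβ₄ : β₄ ≤ β := le_trans (le_max_left _ _) hβ
  have hs : 0 < a β := ha β
  have hsa := hβa β (le_trans (le_max_right _ _) hβ)
  have hsc : a β ≤ c₀ / 2 := hsa.trans (min_le_left _ _)
  have hsh : a β ≤ 3 * hc / 8 := hsa.trans ((min_le_right _ _).trans (min_le_left _ _))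
  have hs1 : a β ≤ 1 := hsa.trans ((min_le_right _ _).trans (min_le_right _ _))
  have hLδ : 2 * |δ₂| + 1 ≤ a β * L := (le_max_left _ _).trans hL
  have hLc : 4 * c₀ + 8 ≤ a β * L := (le_max_right _ _).trans hL
  -- the collar radius
  obtain ⟨R, hRdef⟩ : ∃ R : ℕ, R = ⌊c₀ / a β⌋₊ := ⟨_, rfl⟩
  have hRle : (R : ℝ) ≤ c₀ / a β := by rw [hRdef]; exact Nat.floor_le (by positivity)
  have hRlt : c₀ / a β < R + 1 := by rw [hRdef]; exact Nat.lt_floor_add_one _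
  have hc2 : 2 ≤ c₀ / a β := by rw [le_div_iff₀ hs]; linarith
  have hR1 : 1 ≤ R := by exact_mod_cast (show (1 : ℝ) ≤ R by linarith)
  have hRc : (R : ℝ) * a β ≤ c₀ := by rwa [le_div_iff₀ hs] at hRle
  have hRs : (R : ℝ) * a β ≤ ℓ₄ := hRc.trans (by rw [hc₀]; exact min_le_right _ _)
  have hRL : 4 * R + 8 ≤ L := by
    have h1 : ((4 * R + 8 : ℕ) : ℝ) * a β ≤ (L : ℝ) * a β := by push_cast; nlinarith
    exact_mod_cast le_of_mul_le_mul_right h1 hs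
  have hRsep : (2 * R + 4 : ℝ) ≤ 2 * hc / a β := by
    rw [le_div_iff₀ hs]; nlinarith
  have hRhalf : c₀ / 2 / a β ≤ R := by
    rw [div_div, show c₀ / (2 * a β) = c₀ / a β / 2 by rw [div_div, mul_comm]]; linarith
  -- the `n = 2` collar output at this coupling / torus / radius
  have H : ∀ (n : ℕ) (q : Fin n → Fin 4 × Fin 4) (x : Fin n → (Fin 4 → ℤ)), (∀ i, (q i).1 < (q i).2) →
      (∀ i j : Fin n, i ≠ j → ∃ k : Fin 4,
        (2 * (R : ℤ) + 4) ≤ |((((x i k - x j k : ℤ) : ZMod (2 * L + 1))).valMinAbs : ℤ)|) →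
      |torusE G r β L (fun U => ∏ i, (plane G r (q i) (x i) U - torusE G r β L (plane G r (q i) (x i))))| ≤
        (C / (R : ℝ) ^ 4) ^ n :=
    fun n q x hq hsep => hMB β hβ₄ L n q x R hq hR1 hRs hRL hsep
  -- the weights and the `ℤ⁴` observable
  set s : ℝ := a β with hsdef
  set c : FinTorusSite (2 * L + 1) (2 * L + 1) (2 * L + 1) (2 * L + 1) → ℝ :=
    fun u => g (s • siteToE (zOf (2 * L + 1) u)) with hcdef
  have hcv : ∀ u, c u = v (s • siteToE (zOf (2 * L + 1) u) + (s * k) • EuclideanSpace.single (0 : Fin 4) (1 : ℝ)) := by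
    intro u; rw [hcdef]; dsimp only; rw [hg, mul_smul]
  -- Σ |c| ≤ K'/s⁴
  have hsk : s * (k : ℝ) ≤ |δ₁| := by
    have : s * k ≤ δ₁ - hc := by linarith
    linarith [le_abs_self δ₁]
  have hsumc : ∑ u, |c u| ≤ K' / s ^ 4 := by
    have hw : ‖(s * k) • EuclideanSpace.single (0 : Fin 4) (1 : ℝ)‖ ≤ |δ₁| := by
      rw [norm_smul, PiLp.norm_single, norm_one, mul_one, Real.norm_of_nonneg (by positivity)]
      exact hsk
    simp only [hcv]
    refine (sum_abs_translate_le hKv0 hKv L hs hs1 _).trans ?_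
    rw [hK', div_le_div_iff_of_pos_right (by positivity)]
    have : (1 + ‖(s * (k : ℝ)) • EuclideanSpace.single (0 : Fin 4) (1 : ℝ)‖) ^ 8 ≤ (1 + |δ₁|) ^ 8 :=
      pow_le_pow_left₀ (by positivity) (by linarith) 8
    nlinarith [pow_nonneg (show (0:ℝ) ≤ 4 by norm_num) 4]
  -- the per-pair bound
  have hpair : ∀ x y : FinTorusSite (2 * L + 1) (2 * L + 1) (2 * L + 1) (2 * L + 1),
      |c x * c y * (torusE G r β L (fun V => dens G r (zOf (2 * L + 1) y) V * dens G r (zOf (2 * L + 1) x) (cfgReflect V)) -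
        torusE G r β L (dens G r (zOf (2 * L + 1) y)) * torusE G r β L (dens G r (zOf (2 * L + 1) x)))| ≤
      |c x| * |c y| * (36 * (C / (R : ℝ) ^ 4) ^ 2) := by
    intro x y
    rw [abs_mul, abs_mul]
    by_cases hx : c x = 0
    · rw [hx]; simp
    by_cases hy : c y = 0
    · rw [hy]; simp
    refine mul_le_mul_of_nonneg_left ?_ (by positivity)
    rw [hcv] at hx hy
    have wx := window_of_ne_zero hvslab s (s * k) _ hx
    have wy := window_of_ne_zero hvslab s (s * k) _ hy
    refine abs_cov_dens_reflect_le G r β L H _ _ fun q => ?_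
    by_cases hq : q.1.1 = 0
    · rw [if_pos hq]
      exact sep_charged hs hs1 hk hLδ hRsep _ _ wx wy 1 (Or.inr rfl) _ (by simp; ring)
    · rw [if_neg hq]
      exact sep_charged hs hs1 hk hLδ hRsep _ _ wx wy 0 (Or.inl rfl) _ (by simp)
  -- assembly: the route's `Qrp` is the mirror covariance of `Φ_g = Σ_u c_u · dens (zOf u)`
  obtain ⟨Φ, hΦ⟩ : ∃ Φ : LGConfig 4 G → ℝ, Φ = fun V => ∑ x, c x * dens G r (zOf (2 * L + 1) x) V := ⟨_, rfl⟩
  obtain ⟨f, hf⟩ : ∃ f : FinTorusSite (2 * L + 1) (2 * L + 1) (2 * L + 1) (2 * L + 1) → LGConfig 4 G → ℝ,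
      f = fun x V => c x * dens G r (zOf (2 * L + 1) x) (cfgReflect V) := ⟨_, rfl⟩
  obtain ⟨g', hg'⟩ : ∃ g' : FinTorusSite (2 * L + 1) (2 * L + 1) (2 * L + 1) (2 * L + 1) → LGConfig 4 G → ℝ,
      g' = fun x V => c x * dens G r (zOf (2 * L + 1) x) V := ⟨_, rfl⟩
  have hfc : ∀ x, Continuous (f x) := fun x => by
    rw [hf]; exact continuous_const.mul ((continuous_dens r _).comp
      Summit.QuantumFields.YangMills.Cruxes.NT.MarkovMirror.continuous_cfgReflect)
  have hgc : ∀ x, Continuous (g' x) := fun x => by rw [hg']; exact continuous_const.mul (continuous_dens r _)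
  have hB : ∀ W : FinTorusSite (2 * L + 1) (2 * L + 1) (2 * L + 1) (2 * L + 1) × Fin 4 → G,
      (∑ x, c x * aF r x W) =
        Φ (torusLift (2 * L + 1) (configPerm (finRotate 4) ((finTorusConfigEquivSite G (2 * L + 1)).symm W))) := by
    intro W
    rw [hΦ]
    exact Finset.sum_congr rfl fun x _ => by rw [← congrFun (toFin_dens_zOf (G := G) r L x) W]
  have e1 : (fun V => Φ (cfgReflect V) * Φ V) = fun V => (∑ x, f x V) * ∑ y, g' y V := by
    funext V; simp only [hΦ, hf, hg']
  have e2 : (fun V => Φ (cfgReflect V)) = fun V => ∑ x, f x V := by funext V; simp only [hΦ, hf]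
  have e3 : Φ = fun V => ∑ y, g' y V := by funext V; simp only [hΦ, hg']
  have hterm : ∀ x y : FinTorusSite (2 * L + 1) (2 * L + 1) (2 * L + 1) (2 * L + 1),
      torusE G r β L (fun V => f x V * g' y V) - torusE G r β L (f x) * torusE G r β L (g' y) =
      c x * c y * (torusE G r β L (fun V => dens G r (zOf (2 * L + 1) y) V * dens G r (zOf (2 * L + 1) x) (cfgReflect V)) -
        torusE G r β L (dens G r (zOf (2 * L + 1) y)) * torusE G r β L (dens G r (zOf (2 * L + 1) x))) := by
    intro x y
    have e4 : (fun V => f x V * g' y V) =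
        fun V => (c x * c y) * (dens G r (zOf (2 * L + 1) y) V * dens G r (zOf (2 * L + 1) x) (cfgReflect V)) := by
      funext V; simp only [hf, hg']; ring
    rw [e4, show f x = fun V => c x * dens G r (zOf (2 * L + 1) x) (cfgReflect V) by rw [hf],
      show g' y = fun V => c y * dens G r (zOf (2 * L + 1) y) V by rw [hg'],
      torusE_const_mul G r β L, torusE_const_mul G r β L, torusE_const_mul G r β L,
      torusE_comp_cfgReflect G r β L (dens G r (zOf (2 * L + 1) x))]
    ring
  have key : eF r β (2 * L + 1) (fun V => (∑ x, c x * aF r x (fun e => if e.2 = Fin.last 3 then (V ((e.1.1, e.1.2.1, e.1.2.2.1, Fin.rev e.1.2.2.2), Fin.last 3))⁻¹ else V ((e.1.1, e.1.2.1, e.1.2.2.1, ⟨((2 * L + 1) - e.1.2.2.2.val) % (2 * L + 1), Nat.mod_lt _ e.1.2.2.2.pos⟩), e.2))) * ∑ x, c x * aF r x V) -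
      eF r β (2 * L + 1) (fun V => ∑ x, c x * aF r x (fun e => if e.2 = Fin.last 3 then (V ((e.1.1, e.1.2.1, e.1.2.2.1, Fin.rev e.1.2.2.2), Fin.last 3))⁻¹ else V ((e.1.1, e.1.2.1, e.1.2.2.1, ⟨((2 * L + 1) - e.1.2.2.2.val) % (2 * L + 1), Nat.mod_lt _ e.1.2.2.2.pos⟩), e.2))) * eF r β (2 * L + 1) (fun V => ∑ x, c x * aF r x V) ≤
      K' ^ 2 * (36 * (C ^ 2 * (2 / c₀) ^ 8)) := by
    simp only [hB]
    rw [covF_toFin_reflF (G := G) r β L Φ Φ, e1, e2, e3, cov_sum_mul_sum r β L f g' hfc hgc]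
    refine (le_abs_self _).trans ((Finset.abs_sum_le_sum_abs _ _).trans ?_)
    have hrow : ∀ x ∈ (Finset.univ : Finset (FinTorusSite (2 * L + 1) (2 * L + 1) (2 * L + 1) (2 * L + 1))),
        |∑ y, (torusE G r β L (fun V => f x V * g' y V) - torusE G r β L (f x) * torusE G r β L (g' y))| ≤
        |c x| * (K' / s ^ 4) * (36 * (C / (R : ℝ) ^ 4) ^ 2) := by
      intro x _
      refine (Finset.abs_sum_le_sum_abs _ _).trans ?_
      simp only [hterm]
      refine (Finset.sum_le_sum fun y _ => hpair x y).trans ?_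
      rw [← Finset.sum_mul, ← Finset.mul_sum]
      exact mul_le_mul_of_nonneg_right (mul_le_mul_of_nonneg_left hsumc (abs_nonneg _)) (by positivity)
    refine (Finset.sum_le_sum hrow).trans ?_
    rw [← Finset.sum_mul, ← Finset.sum_mul]
    have hCR : C / (R : ℝ) ^ 4 ≤ C * (s / (c₀ / 2)) ^ 4 := div_pow_depth_le hC0 (by positivity) hs hRhalf
    have h36 : 36 * (C / (R : ℝ) ^ 4) ^ 2 ≤ 36 * (C * (s / (c₀ / 2)) ^ 4) ^ 2 :=
      mul_le_mul_of_nonneg_left (pow_le_pow_left₀ (by positivity) hCR 2) (by norm_num)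
    calc (∑ x, |c x|) * (K' / s ^ 4) * (36 * (C / (R : ℝ) ^ 4) ^ 2)
        ≤ (K' / s ^ 4) * (K' / s ^ 4) * (36 * (C * (s / (c₀ / 2)) ^ 4) ^ 2) :=
          mul_le_mul (mul_le_mul_of_nonneg_right hsumc (by positivity)) h36 (by positivity) (by positivity)
      _ = K' ^ 2 * (36 * (C ^ 2 * (2 / c₀) ^ 8)) := by field_simp
  exact key

end Summit.QuantumFields.YangMills.Theorems.FemtoCeilingProof

end
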